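/-
Copyright: the b2b-balaban cell (near-miss cell 7), T⁴-continuum CRUX team (coordinator ruling e34b3e0c item (2)),
lineage t4-ne7b-formalise-leaf-02 (gen 127; E-side ∕ key-readings). Released under the licence of the surrounding project.
-/
import Summits.QuantumFields.BalabanUV.T4Continuum.Spine.NE7b.InducedMeanLatticeGrowth

/-!
# THE GROWTH LETTER ON THE DISCRETE TORUS `(ℤ∕Lℤ)^d`, UNIFORMLY IN `L`: the volume-free buffer for torus-indexed blocks
# (row NE7b, node U5c; the (R1″) ∕ (R1′b) residual of the LCS road in MODEL form — sequel to `…InducedMeanLatticeGrowth`)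

Cell `pub-balaban/t4`, spine estimate NE7b (`T4WeightBudget.RelWeightBound`; the cell's OWN estimate — NOT PRINTED in
[Bałaban 1983–89], NOT PROVED).  [folklore] finite counting over `ZMod L` + the junctions of the prequel; NOTHING of Bałaban's
is named, valued or asserted; no `T4Continuum/Support` leaf typed (FREEZE (0)); 0 `def`, 0 `sorry`.

WHY.  `…InducedMeanLatticeGrowth` (this lineage) makes the induced-mean energy `B₀` of the LCS road VOLUME-FREE under a
ball-growth letter and DISCHARGES that letter for indices read on `ℤ^d` (`card_filter_le_of_siteReading`).  The row's lattices
are finite TORI (the `T⁴` of the headline; unit lattices `T_η` of side `L`): sites live in `(ℤ∕Lℤ)^d`, distances are torus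
distances, and a reading into `ℤ^d` is not available globally.  THIS FILE discharges the same letter for a TORUS READING
`ξ : n → (Fin d → ZMod L)` with the torus coordinate distance written WITHOUT a new definition as
`|(ξ_l(i) − ξ_j(i)).valMinAbs|` (Mathlib's `ZMod.valMinAbs` = the representative in `(−L∕2, L∕2]`, so its modulus IS the
distance around the circle `ℤ∕Lℤ`): `#{l ∈ D | d(j,l) < r+1} ≤ m·(2r+1)^d` for EVERY `L` (also `L = 0`, where `ZMod 0 = ℤ` and
the statement is the `ℤ^d` one) — uniformly in the side `L`, i.e. in the volume.

WHAT IS PROVED ([folklore]):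
* §1 `natAbs_valMinAbs_le_of_lt` (an integer of modulus `< r+1` has modulus `≤ r`, in the cast currency of the letters),
  **`card_image_le_torusBox`** (the read sites of `{l ∈ D | d(j,l) < r+1}` inject, by `w ↦ (i ↦ (w i − ξ_j i).valMinAbs)`
  (`ZMod.injective_valMinAbs`), into the box `Icc(−r, r)^d ⊂ ℤ^d` of cardinal `(2r+1)^d`), **`card_filter_le_of_torusReading`**
  (fibres `≤ m` ⟹ `#{l ∈ D | d(j,l) < r+1} ≤ m·(2r+1)^d`), **`polyGrowth_of_torusReading`** (the prequel's polynomial letter with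
  `A = m·2^d`, `k = d`), `sum_exp_le_of_torusReading` (the decay sum with a buffer, volume-free, on the torus);
  §1b the BLOCK METRIC (distances in units of blocks of side `s`, e.g. `s = L^k` for an `L^k`-lattice read on the fine torus):
  `card_image_le_scaledTorusBox` (`≤ (2s(r+1)+1)^d`), **`polyGrowth_of_scaledTorusReading`** (`A = m·(3s)^d`, `k = d`).
* §2 JUNCTIONS BY NAME (the prequel's `inducedMeanEnergy_le_of_polyGrowth` ∕ the OWNER's `shiftedMoment_le_of_inducedMean_le`):
  **`inducedMeanEnergy_le_of_torusReading`** (`mᵀQm ≤ q₀·#Z·(C·V·((m·2^d)·(d!∕(μ∕2)^d)·e^{μ∕2}∕(1−e^{−μ∕2}))·e^{−(μ∕2)R})²` for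
  torus-read indices — no `#D`, no `L`), **`shiftedMoment_le_of_torusReading`** (`hB` DISCHARGED volume-free on the torus;
  `hmass` displayed), `windowEnergy_le_of_growth` (the (R1′c) nesting letters `μ_b` WITHOUT a buffer and WITHOUT `#D`, any reading —
  F1's `windowEnergy_le_of_decay` with `#D ↦ Γ`), `inducedMeanEnergy_le_of_scaledTorusReading` (block metric: `s^d` enters once, via `A`).
* §3 a decided toy (`Fin 5` read on `ℤ∕5ℤ` by the cast: the torus-reading hypotheses are jointly inhabited, and the
  distance between `0` and `4` is `1`).
NOT HERE (honest): that Bałaban's fluctuation forms SUPPLY the decay letter on the torus (`C, μ` uniform in the running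
coupling; print's random-walk expansions [B13]∕[B14]), the interface reading `D, V`, the buffer `R` — the (A1c) INSTANCE
(NC-NE7b-α UNRULED), not claimed; (R1′c), (R2′), (A3); anything of Bałaban's.  BY-NAME EFFECT ON THE WALL: NONE (a model
supplier).  NE7b NOT PRINTED ∕ NOT PROVED; spine PROVED 0∕9; rung (B)+1 on ONE finite T⁴ — NOT infinite volume, NOT the mass gap,
NOT Clay.  HONEST DEPENDENCY: continuum YM on T⁴ ⇐ BetaPertH ∧ nine spine estimates (0∕9 proved); BetaPertH ⇐ (D1) ∧ (D4) ∧
CAP+tail; G-an2-4 gates asym, D1 and NE2∕3∕4.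
-/

set_option autoImplicit false
open Matrix Finset MeasureTheory Real
open Summit.QuantumFields.BalabanUV.T4Continuum.NE7b.GaussianShiftedFibre
open Summit.QuantumFields.BalabanUV.T4Continuum.NE7b.GaussianInducedMeanDecay
open Summit.QuantumFields.BalabanUV.T4Continuum.NE7b.InducedMeanLatticeGrowth

namespace Summit.QuantumFields.BalabanUV.T4Continuum.NE7b.InducedMeanTorusGrowth
variable {n : Type*} {dd L : ℕ}

/-! ## §1 The torus box: read sites within torus distance `r` inject into `Icc(−r, r)^d ⊂ ℤ^d` -/

/-- An integer whose modulus, cast to `ℝ`, is `< r + 1` lies in `[−r, r]`. [folklore] -/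
theorem natAbs_valMinAbs_le_of_lt (z : ℤ) (r : ℕ) (h : ((z.natAbs : ℕ) : ℝ) < (r : ℝ) + 1) : -(r : ℤ) ≤ z ∧ z ≤ (r : ℤ) := by
  have h1 : z.natAbs < r + 1 := by exact_mod_cast h
  have h2 : z.natAbs ≤ r := Nat.lt_succ_iff.1 h1
  have h3 : (z.natAbs : ℤ) ≤ (r : ℤ) := by exact_mod_cast h2
  rw [Int.natCast_natAbs] at h3
  exact ⟨by linarith [(abs_le.1 h3).1], (abs_le.1 h3).2⟩

/-- **THE TORUS BOX.**  For a torus reading `ξ : n → (Fin d → ZMod L)` whose coordinate torus distances from `ξ_j` are dominated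
by the pseudo-distance, `|(ξ_l(i) − ξ_j(i)).valMinAbs| ≤ d(j,l)` on `D`, the read sites of `{l ∈ D | d(j,l) < r+1}` number at
most `(2r+1)^d`: they inject into the box `Icc(−r, r)^d` of `ℤ^d` by `w ↦ (i ↦ (w i − ξ_j i).valMinAbs)`
(`ZMod.injective_valMinAbs`).  Every `L` (no `NeZero`, no `Fintype` of the torus needed). [folklore] -/
theorem card_image_le_torusBox [DecidableEq n] (D : Finset n) (d : n → n → ℝ) (j : n) (ξ : n → (Fin dd → ZMod L))
    (hcoord : ∀ l ∈ D, ∀ i, ((((ξ l i - ξ j i).valMinAbs).natAbs : ℕ) : ℝ) ≤ d j l) (r : ℕ) :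
    ((D.filter fun l => d j l < r + 1).image ξ).card ≤ (2 * r + 1) ^ dd := by
  classical
  set F := D.filter fun l => d j l < r + 1 with hF
  have hbox : (Finset.Icc (fun _ : Fin dd => -(r : ℤ)) (fun _ => (r : ℤ))).card = (2 * r + 1) ^ dd := by
    rw [Pi.card_Icc]
    have h : ∀ i : Fin dd, (Finset.Icc (-(r : ℤ)) (r : ℤ)).card = 2 * r + 1 := fun i => by
      have e : (r : ℤ) + 1 - -(r : ℤ) = ((2 * r + 1 : ℕ) : ℤ) := by push_cast; ring
      rw [Int.card_Icc, e, Int.toNat_natCast]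
    rw [Finset.prod_congr rfl fun i _ => h i, Finset.prod_const, Finset.card_univ, Fintype.card_fin]
  rw [← hbox]
  refine Finset.card_le_card_of_injOn (fun w : Fin dd → ZMod L => fun i => (w i - ξ j i).valMinAbs) ?_ ?_
  · intro w hw
    obtain ⟨l, hl, rfl⟩ := Finset.mem_image.1 (Finset.mem_coe.1 hw)
    rw [hF, Finset.mem_filter] at hl
    have key : ∀ i, -(r : ℤ) ≤ (ξ l i - ξ j i).valMinAbs ∧ (ξ l i - ξ j i).valMinAbs ≤ (r : ℤ) := fun i =>
      natAbs_valMinAbs_le_of_lt _ r ((hcoord l hl.1 i).trans_lt hl.2)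
    rw [Finset.mem_coe, Finset.mem_Icc]
    exact ⟨fun i => (key i).1, fun i => (key i).2⟩
  · intro w _ w' _ h
    funext i
    have hi : (w i - ξ j i).valMinAbs = (w' i - ξ j i).valMinAbs := congr_fun h i
    exact sub_left_injective (ZMod.injective_valMinAbs hi)

/-- **THE GROWTH LETTER ON THE TORUS.**  Torus reading `ξ : n → (Fin d → ZMod L)` with fibres of size `≤ m` on `D` (internal
indices share a site) and coordinate torus distances dominated by `d`: `#{l ∈ D | d(j,l) < r+1} ≤ m·(2r+1)^d` — uniformly in `D`,
in the side `L` of the torus and in the volume. [folklore] -/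
theorem card_filter_le_of_torusReading [DecidableEq n] (D : Finset n) (d : n → n → ℝ) (j : n)
    (ξ : n → (Fin dd → ZMod L)) {m : ℕ} (hmult : ∀ w, (D.filter fun l => ξ l = w).card ≤ m)
    (hcoord : ∀ l ∈ D, ∀ i, ((((ξ l i - ξ j i).valMinAbs).natAbs : ℕ) : ℝ) ≤ d j l) (r : ℕ) :
    (D.filter fun l => d j l < r + 1).card ≤ m * (2 * r + 1) ^ dd := by
  classical
  set F := D.filter fun l => d j l < r + 1 with hF
  have hfib : ∀ w ∈ F.image ξ, (F.filter fun l => ξ l = w).card ≤ m := fun w _ =>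
    (Finset.card_le_card fun l hl => by
      rw [Finset.mem_filter] at hl ⊢
      exact ⟨(Finset.mem_filter.1 hl.1).1, hl.2⟩).trans (hmult w)
  calc F.card ≤ m * (F.image ξ).card := Finset.card_le_mul_card_image F m hfib
    _ ≤ m * (2 * r + 1) ^ dd := Nat.mul_le_mul_left m (card_image_le_torusBox D d j ξ hcoord r)

/-- **THE POLYNOMIAL GROWTH LETTER ON THE TORUS** in the currency of `…InducedMeanLatticeGrowth` §1:
`#{l ∈ D | d(j,l) < r+1} ≤ (m·2^d)·(r+1)^d`. [folklore] -/
theorem polyGrowth_of_torusReading [DecidableEq n] (D : Finset n) (d : n → n → ℝ) (j : n)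
    (ξ : n → (Fin dd → ZMod L)) {m : ℕ} (hmult : ∀ w, (D.filter fun l => ξ l = w).card ≤ m)
    (hcoord : ∀ l ∈ D, ∀ i, ((((ξ l i - ξ j i).valMinAbs).natAbs : ℕ) : ℝ) ≤ d j l) (r : ℕ) :
    ((D.filter fun l => d j l < r + 1).card : ℝ) ≤ ((m : ℝ) * 2 ^ dd) * ((r : ℝ) + 1) ^ dd := by
  have h1 : ((D.filter fun l => d j l < r + 1).card : ℝ) ≤ (m : ℝ) * (2 * (r : ℝ) + 1) ^ dd := by
    exact_mod_cast card_filter_le_of_torusReading D d j ξ hmult hcoord r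
  have h2 : (2 * (r : ℝ) + 1) ^ dd ≤ (2 * ((r : ℝ) + 1)) ^ dd :=
    pow_le_pow_left₀ (by positivity) (by linarith) dd
  calc ((D.filter fun l => d j l < r + 1).card : ℝ) ≤ (m : ℝ) * (2 * (r : ℝ) + 1) ^ dd := h1
    _ ≤ (m : ℝ) * (2 * ((r : ℝ) + 1)) ^ dd := mul_le_mul_of_nonneg_left h2 (Nat.cast_nonneg m)
    _ = ((m : ℝ) * 2 ^ dd) * ((r : ℝ) + 1) ^ dd := by rw [mul_pow]; ring

/-- **THE TORUS DECAY SUM WITH A BUFFER, VOLUME-FREE**: torus reading with fibres `≤ m`, coordinate torus distances dominated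
by `d`, `μ > 0`, buffer `d(j, D) ≥ R` ⟹
`Σ_{l∈D} e^{−μ d(j,l)} ≤ (m·2^d)·(d!∕(μ∕2)^d)·e^{μ∕2}∕(1 − e^{−μ∕2}) · e^{−(μ∕2)R}` — no `#D`, no `L`. [folklore] -/
theorem sum_exp_le_of_torusReading [DecidableEq n] (D : Finset n) (d : n → n → ℝ) (j : n)
    (ξ : n → (Fin dd → ZMod L)) {m : ℕ} (hmult : ∀ w, (D.filter fun l => ξ l = w).card ≤ m)
    (hcoord : ∀ l ∈ D, ∀ i, ((((ξ l i - ξ j i).valMinAbs).natAbs : ℕ) : ℝ) ≤ d j l) {μ : ℝ} (hμ : 0 < μ)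
    {R : ℕ} (hR : ∀ l ∈ D, (R : ℝ) ≤ d j l) :
    ∑ l ∈ D, exp (-(μ * d j l)) ≤
      ((m : ℝ) * 2 ^ dd) * ((dd.factorial : ℝ) / (μ / 2) ^ dd) * exp (μ / 2) / (1 - exp (-(μ / 2))) *
        exp (-(μ / 2 * R)) :=
  sum_exp_le_of_polyGrowth D d j hμ (by positivity) (polyGrowth_of_torusReading D d j ξ hmult hcoord) hR

/-! ## §1b Scaled (block) readings: the pseudo-distance in units of blocks of side `s` -/

/-- **THE SCALED TORUS BOX** (block metric).  If the pseudo-distance is measured in BLOCKS of side `s : ℕ` — the coordinate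
torus distances are dominated by `s·d(j,l)` (`|(ξ_l(i) − ξ_j(i)).valMinAbs| ≤ s·d(j,l)` on `D`; e.g. `d` = the block distance of an
`L^k`-lattice read on the fine torus, `s = L^k`) — then the read sites of `{l ∈ D | d(j,l) < r+1}` inject into the box
`Icc(−s(r+1), s(r+1))^d`, so they number at most `(2s(r+1)+1)^d`. [folklore] -/
theorem card_image_le_scaledTorusBox [DecidableEq n] (D : Finset n) (d : n → n → ℝ) (j : n) (ξ : n → (Fin dd → ZMod L))
    (s : ℕ) (hcoord : ∀ l ∈ D, ∀ i, ((((ξ l i - ξ j i).valMinAbs).natAbs : ℕ) : ℝ) ≤ s * d j l) (r : ℕ) :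
    ((D.filter fun l => d j l < r + 1).image ξ).card ≤ (2 * (s * (r + 1)) + 1) ^ dd := by
  classical
  set F := D.filter fun l => d j l < r + 1 with hF
  set b : ℕ := s * (r + 1) with hb
  have hbox : (Finset.Icc (fun _ : Fin dd => -(b : ℤ)) (fun _ => (b : ℤ))).card = (2 * b + 1) ^ dd := by
    rw [Pi.card_Icc]
    have h : ∀ i : Fin dd, (Finset.Icc (-(b : ℤ)) (b : ℤ)).card = 2 * b + 1 := fun i => by
      have e : (b : ℤ) + 1 - -(b : ℤ) = ((2 * b + 1 : ℕ) : ℤ) := by push_cast; ring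
      rw [Int.card_Icc, e, Int.toNat_natCast]
    rw [Finset.prod_congr rfl fun i _ => h i, Finset.prod_const, Finset.card_univ, Fintype.card_fin]
  rw [← hbox]
  refine Finset.card_le_card_of_injOn (fun w : Fin dd → ZMod L => fun i => (w i - ξ j i).valMinAbs) ?_ ?_
  · intro w hw
    obtain ⟨l, hl, rfl⟩ := Finset.mem_image.1 (Finset.mem_coe.1 hw)
    rw [hF, Finset.mem_filter] at hl
    have key : ∀ i, -(b : ℤ) ≤ (ξ l i - ξ j i).valMinAbs ∧ (ξ l i - ξ j i).valMinAbs ≤ (b : ℤ) := fun i => by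
      have h1 : ((((ξ l i - ξ j i).valMinAbs).natAbs : ℕ) : ℝ) ≤ (s : ℝ) * ((r : ℝ) + 1) :=
        (hcoord l hl.1 i).trans (mul_le_mul_of_nonneg_left hl.2.le (Nat.cast_nonneg s))
      have h2 : ((ξ l i - ξ j i).valMinAbs).natAbs ≤ b := by rw [hb]; exact_mod_cast h1
      have h3 : ((((ξ l i - ξ j i).valMinAbs).natAbs : ℕ) : ℤ) ≤ (b : ℤ) := by exact_mod_cast h2
      rw [Int.natCast_natAbs] at h3
      exact ⟨by linarith [(abs_le.1 h3).1], (abs_le.1 h3).2⟩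
    rw [Finset.mem_coe, Finset.mem_Icc]
    exact ⟨fun i => (key i).1, fun i => (key i).2⟩
  · intro w _ w' _ h
    funext i
    have hi : (w i - ξ j i).valMinAbs = (w' i - ξ j i).valMinAbs := congr_fun h i
    exact sub_left_injective (ZMod.injective_valMinAbs hi)

/-- **THE GROWTH LETTER IN THE BLOCK METRIC.**  Torus reading with fibres `≤ m` on `D` and coordinate torus distances dominated by
`s·d(j,l)` (`1 ≤ s`): `#{l ∈ D | d(j,l) < r+1} ≤ (m·(3s)^d)·(r+1)^d` — the polynomial letter of `…InducedMeanLatticeGrowth` with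
`A = m·(3s)^d` (one block's worth of sites per unit of `d`), `k = d`; uniformly in `L`. [folklore] -/
theorem polyGrowth_of_scaledTorusReading [DecidableEq n] (D : Finset n) (d : n → n → ℝ) (j : n)
    (ξ : n → (Fin dd → ZMod L)) {m : ℕ} (hmult : ∀ w, (D.filter fun l => ξ l = w).card ≤ m) {s : ℕ} (hs : 1 ≤ s)
    (hcoord : ∀ l ∈ D, ∀ i, ((((ξ l i - ξ j i).valMinAbs).natAbs : ℕ) : ℝ) ≤ s * d j l) (r : ℕ) :
    ((D.filter fun l => d j l < r + 1).card : ℝ) ≤ ((m : ℝ) * (3 * (s : ℝ)) ^ dd) * ((r : ℝ) + 1) ^ dd := by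
  classical
  set F := D.filter fun l => d j l < r + 1 with hF
  have hfib : ∀ w ∈ F.image ξ, (F.filter fun l => ξ l = w).card ≤ m := fun w _ =>
    (Finset.card_le_card fun l hl => by
      rw [Finset.mem_filter] at hl ⊢
      exact ⟨(Finset.mem_filter.1 hl.1).1, hl.2⟩).trans (hmult w)
  have h1 : F.card ≤ m * (2 * (s * (r + 1)) + 1) ^ dd :=
    (Finset.card_le_mul_card_image F m hfib).trans
      (Nat.mul_le_mul_left m (card_image_le_scaledTorusBox D d j ξ s hcoord r))
  have h1' : (F.card : ℝ) ≤ (m : ℝ) * (2 * ((s : ℝ) * ((r : ℝ) + 1)) + 1) ^ dd := by exact_mod_cast h1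
  have hs' : (1 : ℝ) ≤ (s : ℝ) * ((r : ℝ) + 1) :=
    le_trans (by exact_mod_cast hs) (le_mul_of_one_le_right (Nat.cast_nonneg s) (by linarith [(Nat.cast_nonneg r : (0:ℝ) ≤ r)]))
  have h2 : (2 * ((s : ℝ) * ((r : ℝ) + 1)) + 1) ^ dd ≤ (3 * ((s : ℝ) * ((r : ℝ) + 1))) ^ dd :=
    pow_le_pow_left₀ (by positivity) (by linarith) dd
  calc (F.card : ℝ) ≤ (m : ℝ) * (2 * ((s : ℝ) * ((r : ℝ) + 1)) + 1) ^ dd := h1'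
    _ ≤ (m : ℝ) * (3 * ((s : ℝ) * ((r : ℝ) + 1))) ^ dd := mul_le_mul_of_nonneg_left h2 (Nat.cast_nonneg m)
    _ = ((m : ℝ) * (3 * (s : ℝ)) ^ dd) * ((r : ℝ) + 1) ^ dd := by
        rw [show (3 * ((s : ℝ) * ((r : ℝ) + 1))) = (3 * (s : ℝ)) * ((r : ℝ) + 1) by ring, mul_pow]; ring

/-! ## §2 Junctions BY NAME: `B₀` and the shifted moment for torus-read indices -/

section Junction
variable [Fintype n] [DecidableEq n]

/-- **`B₀` ON THE TORUS, VOLUME-FREE**: indices read on `(ℤ∕Lℤ)^d` by `ξ` with fibres `≤ m` on `D` and coordinate torus distances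
dominated by `d` at every `i ∈ Z`; decay letter (`μ > 0`), `Q` on `Z` with `Q ≤ q₀·1`, exterior term on `D` with `|v| ≤ V`,
buffer `R`.  Then `mᵀQm ≤ q₀·#Z·(C·V·((m·2^d)·(d!∕(μ∕2)^d)·e^{μ∕2}∕(1−e^{−μ∕2}))·e^{−(μ∕2)R})²` — no `#D`, no `L`: the buffer
that makes `B₀ = O(q₀#Z)` is independent of the far component AND of the side of the torus. [folklore] -/
theorem inducedMeanEnergy_le_of_torusReading (S Q : Matrix n n ℝ) {C μ : ℝ} (d : n → n → ℝ) (hμ : 0 < μ)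
    (hdec : ∀ i k, |S⁻¹ i k| ≤ C * Real.exp (-(μ * d i k)))
    (hQ : Q.PosSemidef) (Z : Finset n) (hQZ : ∀ i j, j ∉ Z → Q i j = 0) {q₀ : ℝ} (hq₀ : 0 ≤ q₀)
    (hQq : (q₀ • (1 : Matrix n n ℝ) - Q).PosSemidef)
    (D : Finset n) (v : n → ℝ) (hvD : ∀ l, l ∉ D → v l = 0) {V : ℝ} (hV0 : 0 ≤ V) (hV : ∀ l ∈ D, |v l| ≤ V)
    (ξ : n → (Fin dd → ZMod L)) {m : ℕ} (hmult : ∀ w, (D.filter fun l => ξ l = w).card ≤ m)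
    (hcoord : ∀ i ∈ Z, ∀ l ∈ D, ∀ c, ((((ξ l c - ξ i c).valMinAbs).natAbs : ℕ) : ℝ) ≤ d i l)
    {R : ℕ} (hR : ∀ i ∈ Z, ∀ l ∈ D, (R : ℝ) ≤ d i l) :
    (S⁻¹ *ᵥ v) ⬝ᵥ (Q *ᵥ (S⁻¹ *ᵥ v)) ≤
      q₀ * Z.card * (C * V *
        (((m : ℝ) * 2 ^ dd) * ((dd.factorial : ℝ) / (μ / 2) ^ dd) * exp (μ / 2) / (1 - exp (-(μ / 2))) *
          exp (-(μ / 2 * R)))) ^ 2 :=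
  inducedMeanEnergy_le_of_polyGrowth S Q d hμ hdec hQ Z hQZ hq₀ hQq D v hvD hV0 hV (by positivity)
    (fun i hi => polyGrowth_of_torusReading D d i ξ hmult (hcoord i hi)) hR

/-- **THE SHIFTED RESTRICTED MOMENT WITH THE TORUS BUFFER PRICE** = the OWNER's
`…GaussianShiftedFibre.shiftedMoment_le_of_inducedMean_le` with `hB` DISCHARGED by `inducedMeanEnergy_le_of_torusReading`:
the exterior coupling of a torus-indexed near block costs
`exp((1+ε⁻¹)·q₀·#Z·(C·V·Γ_T·e^{−(μ∕2)R})²)`, `Γ_T = (m·2^d)·(d!∕(μ∕2)^d)·e^{μ∕2}∕(1−e^{−μ∕2})` — free of `#D`, of the side `L`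
and of the far characteristic functions; `hmass` stays displayed ((R1′c)). [folklore] -/
theorem shiftedMoment_le_of_torusReading {S Q : Matrix n n ℝ} {δ' ε η : ℝ} {r : ℕ} (hS : S.PosDef)
    (hQ : Q.PosSemidef) (hε : 0 < ε) (hdom : (δ' • S - (1 + ε) • Q).PosSemidef) (hδ0 : 0 ≤ δ') (hδ : δ' < 1)
    (hr : Q.rank ≤ r) (v : n → ℝ) {F : (n → ℝ) → ℝ} (hF0 : ∀ x, 0 ≤ F x) (hF1 : ∀ x, F x ≤ 1) (hFm : Measurable F)
    (hη : η < 1)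
    (hmass : ∫ u, (1 - F (u - S⁻¹ *ᵥ v)) * exp (-(u ⬝ᵥ (S *ᵥ u))) ≤ η * ∫ u, exp (-(u ⬝ᵥ (S *ᵥ u))))
    {C μ : ℝ} (d : n → n → ℝ) (hμ : 0 < μ) (hdec : ∀ i k, |S⁻¹ i k| ≤ C * Real.exp (-(μ * d i k)))
    (Z : Finset n) (hQZ : ∀ i j, j ∉ Z → Q i j = 0) {q₀ : ℝ} (hq₀ : 0 ≤ q₀)
    (hQq : (q₀ • (1 : Matrix n n ℝ) - Q).PosSemidef)
    (D : Finset n) (hvD : ∀ l, l ∉ D → v l = 0) {V : ℝ} (hV0 : 0 ≤ V) (hV : ∀ l ∈ D, |v l| ≤ V)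
    (ξ : n → (Fin dd → ZMod L)) {m : ℕ} (hmult : ∀ w, (D.filter fun l => ξ l = w).card ≤ m)
    (hcoord : ∀ i ∈ Z, ∀ l ∈ D, ∀ c, ((((ξ l c - ξ i c).valMinAbs).natAbs : ℕ) : ℝ) ≤ d i l)
    {R : ℕ} (hR : ∀ i ∈ Z, ∀ l ∈ D, (R : ℝ) ≤ d i l) :
    ∫ x, F x * (exp (x ⬝ᵥ (Q *ᵥ x)) * exp (-(x ⬝ᵥ (S *ᵥ x) + 2 * (x ⬝ᵥ v)))) ≤
      (exp ((1 + ε⁻¹) * (q₀ * Z.card * (C * V *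
          (((m : ℝ) * 2 ^ dd) * ((dd.factorial : ℝ) / (μ / 2) ^ dd) * exp (μ / 2) / (1 - exp (-(μ / 2))) *
            exp (-(μ / 2 * R)))) ^ 2)) *
          ((√(1 - δ'))⁻¹ ^ r / (1 - η))) *
        ∫ x, F x * exp (-(x ⬝ᵥ (S *ᵥ x) + 2 * (x ⬝ᵥ v))) :=
  shiftedMoment_le_of_inducedMean_le hS hQ hε hdom hδ0 hδ hr v hF0 hF1 hFm hη hmass
    (inducedMeanEnergy_le_of_torusReading S Q d hμ hdec hQ Z hQZ hq₀ hQq D v hvD hV0 hV ξ hmult hcoord hR)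

/-- **THE NESTING LETTERS WITHOUT A BUFFER AND WITHOUT `#D`** (= `…GaussianInducedMeanDecay.windowEnergy_le_of_decay` with the
interface cardinal `#D` replaced by `Γ = A·e^ν∕(1−e^{−(μ−ν)})`; any index type, any reading): a window form `Q_b` living on `Z_b`
with `Q_b ≤ q_b·1` may touch the interface (`R = 0`), so only the growth letter at the window's indices and a non-negative
pseudo-distance are asked — `mᵀQ_bm ≤ q_b·#Z_b·(C·V·Γ)²`, the (R1′c) nesting letter `μ_b` free of the far volume. [folklore] -/
theorem windowEnergy_le_of_growth (S Qb : Matrix n n ℝ) {C μ : ℝ} (d : n → n → ℝ) (hdnn : ∀ i l, 0 ≤ d i l)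
    (hdec : ∀ i k, |S⁻¹ i k| ≤ C * Real.exp (-(μ * d i k)))
    (hQb : Qb.PosSemidef) (Zb : Finset n) (hQZ : ∀ i j, j ∉ Zb → Qb i j = 0) {qb : ℝ} (hqb : 0 ≤ qb)
    (hQq : (qb • (1 : Matrix n n ℝ) - Qb).PosSemidef)
    (D : Finset n) (v : n → ℝ) (hvD : ∀ l, l ∉ D → v l = 0) {V : ℝ} (hV0 : 0 ≤ V) (hV : ∀ l ∈ D, |v l| ≤ V)
    {ν A : ℝ} (hν : 0 ≤ ν) (hνμ : ν < μ)
    (hgrowth : ∀ i ∈ Zb, ∀ r : ℕ, ((D.filter fun l => d i l < r + 1).card : ℝ) ≤ A * exp (ν * (r + 1))) :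
    (S⁻¹ *ᵥ v) ⬝ᵥ (Qb *ᵥ (S⁻¹ *ᵥ v)) ≤ qb * Zb.card * (C * V * (A * exp ν / (1 - exp (-(μ - ν))))) ^ 2 := by
  have h := inducedMeanEnergy_le_of_growth S Qb d hdec hQb Zb hQZ hqb hQq D v hvD hV0 hV hν hνμ hgrowth (R := 0)
    (fun i _ l _ => by exact_mod_cast hdnn i l)
  simpa only [Nat.cast_zero, mul_zero, neg_zero, Real.exp_zero, mul_one] using h

/-- **`B₀` IN THE BLOCK METRIC, VOLUME-FREE**: as `inducedMeanEnergy_le_of_torusReading`, with the coordinate torus distances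
dominated by `s·d` (`1 ≤ s`; `d` in block units): `mᵀQm ≤ q₀·#Z·(C·V·((m·(3s)^d)·(d!∕(μ∕2)^d)·e^{μ∕2}∕(1−e^{−μ∕2}))·e^{−(μ∕2)R})²` —
the block volume `s^d` enters ONCE (through `A`), the far volume and the torus side never. [folklore] -/
theorem inducedMeanEnergy_le_of_scaledTorusReading (S Q : Matrix n n ℝ) {C μ : ℝ} (d : n → n → ℝ) (hμ : 0 < μ)
    (hdec : ∀ i k, |S⁻¹ i k| ≤ C * Real.exp (-(μ * d i k)))
    (hQ : Q.PosSemidef) (Z : Finset n) (hQZ : ∀ i j, j ∉ Z → Q i j = 0) {q₀ : ℝ} (hq₀ : 0 ≤ q₀)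
    (hQq : (q₀ • (1 : Matrix n n ℝ) - Q).PosSemidef)
    (D : Finset n) (v : n → ℝ) (hvD : ∀ l, l ∉ D → v l = 0) {V : ℝ} (hV0 : 0 ≤ V) (hV : ∀ l ∈ D, |v l| ≤ V)
    (ξ : n → (Fin dd → ZMod L)) {m : ℕ} (hmult : ∀ w, (D.filter fun l => ξ l = w).card ≤ m) {s : ℕ} (hs : 1 ≤ s)
    (hcoord : ∀ i ∈ Z, ∀ l ∈ D, ∀ c, ((((ξ l c - ξ i c).valMinAbs).natAbs : ℕ) : ℝ) ≤ s * d i l)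
    {R : ℕ} (hR : ∀ i ∈ Z, ∀ l ∈ D, (R : ℝ) ≤ d i l) :
    (S⁻¹ *ᵥ v) ⬝ᵥ (Q *ᵥ (S⁻¹ *ᵥ v)) ≤
      q₀ * Z.card * (C * V *
        (((m : ℝ) * (3 * (s : ℝ)) ^ dd) * ((dd.factorial : ℝ) / (μ / 2) ^ dd) * exp (μ / 2) / (1 - exp (-(μ / 2))) *
          exp (-(μ / 2 * R)))) ^ 2 :=
  inducedMeanEnergy_le_of_polyGrowth S Q d hμ hdec hQ Z hQZ hq₀ hQq D v hvD hV0 hV (by positivity)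
    (fun i hi => polyGrowth_of_scaledTorusReading D d i ξ hmult hs (hcoord i hi)) hR

end Junction

/-! ## §3 A decided toy: five indices read on `ℤ∕5ℤ` by the cast, torus distance `|(l − j).valMinAbs|`, multiplicity `1` — the
torus-reading hypotheses hold, the count reads `≤ 1·(2r+1)^1`, and the distance from `0` to `4` around the circle is `1` -/

example (j : Fin 5) (r : ℕ) :
    ((Finset.univ : Finset (Fin 5)).filter fun l : Fin 5 =>
        (((((((l : ℕ) : ZMod 5) - ((j : ℕ) : ZMod 5)).valMinAbs).natAbs : ℕ) : ℝ)) < r + 1).card ≤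
      1 * (2 * r + 1) ^ 1 := by
  refine card_filter_le_of_torusReading (Finset.univ : Finset (Fin 5))
    (fun (j l : Fin 5) => (((((((l : ℕ) : ZMod 5) - ((j : ℕ) : ZMod 5)).valMinAbs).natAbs : ℕ) : ℝ))) j
    (fun (l : Fin 5) => fun _ : Fin 1 => ((l : ℕ) : ZMod 5)) (m := 1) (fun w => ?_) (fun l _ i => le_rfl) r
  refine Finset.card_le_one.2 fun a ha b hb => ?_
  rw [Finset.mem_filter] at ha hb
  have h : ((a : ℕ) : ZMod 5) = ((b : ℕ) : ZMod 5) := (congr_fun ha.2 0).trans (congr_fun hb.2 0).symm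
  have h2 : (a : ℕ) % 5 = (b : ℕ) % 5 := (ZMod.natCast_eq_natCast_iff' _ _ 5).1 h
  exact Fin.ext (by rw [Nat.mod_eq_of_lt a.2, Nat.mod_eq_of_lt b.2] at h2; exact h2)

example : ((((4 : ℕ) : ZMod 5) - ((0 : ℕ) : ZMod 5)).valMinAbs).natAbs = 1 := by decide

end Summit.QuantumFields.BalabanUV.T4Continuum.NE7b.InducedMeanTorusGrowth
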